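import Summits.QuantumFields.YangMills.Theorems.FluxSectorLaplacePeriodicCoreRaritySubQuartic
import Summits.QuantumFields.YangMills.Theorems.ToronSmallBallPeriodicOffCoreStripWindowDeep
import Summits.QuantumFields.YangMills.Theorems.ToronSmallBallOffCoreStripWindowDeepGlue
import Summits.QuantumFields.YangMills.Theorems.ToronSmallBallAssembly
import Summits.QuantumFields.YangMills.Theorems.FluxSectorLaplaceSectorDecomposition
import Summits.QuantumFields.YangMills.Theorems.FluxSectorLaplaceSectorWeightMonotone
import HarnessLib

/-!
# The thermal small-ball estimate (SB) for EVERY `L ≥ 1` on the Laplace window — the toron-core cruxes re-assembled without their `L`-threshold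

Support module for `SwapTwistDeficit.TwistRatioVanishesFixedL` (item stmt-QuantumFields-23802, O1 of LINE g11-A of seat ym-idea-4; companion
`…TwistRatioVanishesFixedL` closes it).  The landed cruxes ⟨23956⟩ `ToronSmallBall.ToronCoreRaritySubQuartic` and ⟨23957⟩ `OffCoreStripWindowDeep`
STATE an existential threshold `L₀`; their PROOFS hold from `L = 1` on: the leaves `FluxSectorLaplace.fluxSectorSuppression_proof` ⟨24079⟩,
`FluxSectorLaplace.periodicCoreRaritySubQuartic_proof` ⟨24080⟩ and `ToronSmallBall.periodicOffCoreStripWindowDeep_proof` ⟨24089⟩ all take `L₀ = 1` over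
`L`-uniform numerics lemmas (`Flux.sectorWeight_ne_zero_le_rpow_even`, `OwnAxis.numericsCore_of_le`, `OwnAxis.numericsCoreQ_of_le`, `OwnAxis.numerics_of_le`).
This file re-runs those top-level assemblies WITHOUT the threshold (same constants, same bookkeeping — nothing new is estimated):

* §1 `fluxSectorSuppression_allL`, `periodicCoreRarity_allL`, `periodicOffCoreStrip_allL` — the three leaves for every `L ≥ 1` with `L ≤ β^a`;
* §2 `toronCoreRarity_allL` (the bookkeeping of `FluxSectorLaplace.closes`), `offCoreStrip_allL` (that of `ToronSmallBall.offCoreStripWindowDeep_of_sectors`),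
  ★ `smallBall_allL` (that of `…TwistRatioWindow.smallBall_window_of_landed`): there are `0 < a ≤ 1`, `γ < 1/2 − 4a`, `β₀` with
  `insTrace L β 𝟙{|polDist − polDist∘S| ≤ β^{−γ}} 0 ≤ β^{−a}·Z_phys(2L)` for all `β ≥ β₀` and EVERY `L ≥ 1` with `L ≤ β^a`.

HONEST FRAMING: threshold bookkeeping over landed fixed-lattice ∕ window estimates; nothing about infinite volume, the continuum limit or the Clay gap; the
Yang–Mills mass gap is NOT proved.  No `sorry`, no new axiom, no new definition.
References: [cite: tHooft1979Flux]; [cite: Luscher1983, §2]; [cite: MontvayMunster1994, (3.145)].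
-/

set_option autoImplicit false

noncomputable section

open MeasureTheory Filter Topology Real Function
open scoped Matrix ComplexConjugate BigOperators
open Literature.MathematicalPhysics.QuantumLattice
open Literature.MathematicalPhysics.QuantumFieldTheory hiding SU2
open Summit.QuantumFields.YangMills.Theorems

namespace Summit.QuantumFields.YangMills.Theorems.SwapTwistDeficit

open Summit.QuantumFields.YangMills.Theorems.FemtoTransferGap
open Summit.QuantumFields.YangMills.Theorems.FemtoTransferGap.TT
open Summit.QuantumFields.YangMills.Theorems.FemtoTransferGap.FlatSheet

/-! ## §1 The three leaves for every `L ≥ 1` -/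

/-- **Electric-flux sector suppression for every `L ≥ 1` on the window** (the proof of `FluxSectorLaplace.fluxSectorSuppression_proof` ⟨24079⟩ has
`L₀ = 1`): `a = 1/1600`. [cite: tHooft1979Flux] [cite: Luscher1983, §2] -/
theorem fluxSectorSuppression_allL :
    ∃ a : ℝ, 0 < a ∧ ∃ β₀ : ℝ, ∀ β : ℝ, β₀ ≤ β → ∀ (L : ℕ) [NeZero L], (L : ℝ) ≤ β ^ a →
      ∀ z : Fin 3 → Bool, z ≠ (fun _ => false) →
        sectorWeight (L := L) β (2 * L - 1) z (fun _ _ => (1 : ℝ)) ≤ β ^ (-a) * physTrace L β (2 * L) := by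
  obtain ⟨β₀, h⟩ := Flux.sectorWeight_ne_zero_le_rpow_even (a := 1 / 400) (by norm_num) le_rfl
  refine ⟨1 / 1600, by norm_num, max β₀ (max 200 ((13 : ℝ) ^ (1 / (-(-(1 / 1600 : ℝ)))))), fun β hβ L _ hLa z hz => ?_⟩
  simp only [max_le_iff] at hβ
  obtain ⟨hβ₀, h200, h13⟩ := hβ
  have hβ1 : (1 : ℝ) ≤ β := le_trans (by norm_num) h200
  have hβ0 : (0 : ℝ) < β := lt_of_lt_of_le (by norm_num) h200
  have hL1 : 1 ≤ L := NeZero.one_le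
  have hLa' : (L : ℝ) ≤ β ^ (1 / 400 : ℝ) := hLa.trans (Real.rpow_le_rpow_of_exponent_le hβ1 (by norm_num))
  obtain ⟨q, hq⟩ : ∃ q : ℕ, 2 * L - 1 = 1 + (q + q) := ⟨L - 1, by omega⟩
  have hn2 : 1 + (q + q) + 1 ≤ 2 * L := by omega
  have hmain := h β hβ₀ L hLa' q hn2 z hz
  rw [physTrace, hq]
  have hZ : 0 ≤ physTraceSucc L β (1 + (q + q)) := OwnAxis.physTraceSucc_nonneg_of (L := L) (by omega) h200
  have hrate : 13 * β ^ (-((1 / 400 : ℝ) / 2)) ≤ β ^ (-(1 / 1600 : ℝ)) := by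
    have key : 13 * β ^ (-(1 / 1600 : ℝ)) ≤ 1 := OwnAxis.mul_rpow_le_one_of_le (by norm_num) (by norm_num) h13
    have hsplit : β ^ (-((1 / 400 : ℝ) / 2)) = β ^ (-(1 / 1600 : ℝ)) * β ^ (-(1 / 1600 : ℝ)) := by
      rw [← Real.rpow_add hβ0]; norm_num
    rw [hsplit, ← mul_assoc]
    have h0 : 0 ≤ β ^ (-(1 / 1600 : ℝ)) := Real.rpow_nonneg hβ0.le _
    nlinarith
  calc sectorWeight (L := L) β (1 + (q + q)) z (fun _ _ => (1 : ℝ)) ≤ 13 * β ^ (-((1 / 400 : ℝ) / 2)) * physTraceSucc L β (1 + (q + q)) := hmain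
    _ ≤ β ^ (-(1 / 1600 : ℝ)) * physTraceSucc L β (1 + (q + q)) := mul_le_mul_of_nonneg_right hrate hZ

/-- **Periodic-sector toron core rarity for every `L ≥ 1` on the window** (the proof of `FluxSectorLaplace.periodicCoreRaritySubQuartic_proof` ⟨24080⟩ has
`L₀ = 1`): `γc = 2/5`, `a = 1/800`. [cite: Luscher1983, §2] [cite: MontvayMunster1994, (3.145)] -/
theorem periodicCoreRarity_allL :
    ∃ γc : ℝ, γc ≤ 2 / 5 ∧ ∃ a : ℝ, 0 < a ∧ ∃ β₀ : ℝ, ∀ β : ℝ, β₀ ≤ β → ∀ (L : ℕ) [NeZero L], (L : ℝ) ≤ β ^ a →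
      sectorWeight (L := L) β (2 * L - 1) (fun _ => false)
        (fun Us _ => Set.indicator {U : GaugeConfig 3 L SU2 | polDist U ≤ β ^ (-γc)} (fun _ => (1 : ℝ)) (Us 0)) ≤ β ^ (-a) * physTrace L β (2 * L) := by
  obtain ⟨β₀, hnum⟩ := OwnAxis.numericsCore_of_le (a := 1 / 400) (by norm_num) le_rfl
  obtain ⟨β₀', hnumQ⟩ := OwnAxis.numericsCoreQ_of_le (a := 1 / 400) (by norm_num) le_rfl
  refine ⟨2 / 5, le_rfl, 1 / 400 / 2, by norm_num, max (max β₀ β₀') 1, fun β hβ L _ hLa => ?_⟩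
  have hβ₀ : β₀ ≤ β := le_trans (le_trans (le_max_left _ _) (le_max_left _ _)) hβ
  have hβ₀' : β₀' ≤ β := le_trans (le_trans (le_max_right _ _) (le_max_left _ _)) hβ
  have hβ1 : (1 : ℝ) ≤ β := le_trans (le_max_right _ _) hβ
  have hL1 : 1 ≤ L := NeZero.one_le
  have hLa' : (L : ℝ) ≤ β ^ (1 / 400 : ℝ) := hLa.trans (Real.rpow_le_rpow_of_exponent_le hβ1 (by norm_num))
  obtain ⟨h200, -, hfl, h3r, hK1, hβη, hM, hG, hKa, hrate⟩ := hnum β hβ₀ L hL1 hLa'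
  have hQ := hnumQ β hβ₀' L hL1 hLa'
  have hn1 : 1 ≤ 2 * L - 1 := by omega
  have hn2 : 2 * L - 1 + 1 ≤ 2 * L := by omega
  have hZ : physTrace L β (2 * L) = physTraceSucc L β (2 * L - 1) := rfl
  rw [hZ, show -(1 / 400 / 2 : ℝ) = -((1 / 400 : ℝ) / 2) by norm_num]
  exact FluxSectorLaplace.sectorWeight_core_le_of_numerics (L := L) hn1 hn2 h200 hQ hfl h3r hK1 hβη hM hG hKa hrate

set_option maxHeartbeats 800000 in
/-- **Periodic-sector deep off-core strip window for every `L ≥ 1`** (the proof of `ToronSmallBall.periodicOffCoreStripWindowDeep_proof` ⟨24089⟩ has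
`L₀ = 1`): `a₀ = 1/400`, `γ = 1/2 − 4a`. [cite: Luscher1983, §2] [cite: MontvayMunster1994, (3.145)] -/
theorem periodicOffCoreStrip_allL :
    ∀ γc : ℝ, γc ≤ 2 / 5 → ∃ a₀ : ℝ, 0 < a₀ ∧ a₀ ≤ 1 ∧ ∀ a : ℝ, 0 < a → a ≤ a₀ → ∃ γ : ℝ, γ < 1 / 2 - 3 * a ∧ ∃ β₀ : ℝ,
      ∀ β : ℝ, β₀ ≤ β → ∀ (L : ℕ) [NeZero L], (L : ℝ) ≤ β ^ a →
        sectorWeight (L := L) β (2 * L - 1) (fun _ => false)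
          (fun Us _ => Set.indicator {U : GaugeConfig 3 L SU2 |
            |polDist U - polDist (configPerm (Equiv.swap (0 : Fin 3) 1) U)| ≤ β ^ (-γ) ∧ β ^ (-γc) < polDist U} (fun _ => (1 : ℝ)) (Us 0)) ≤
          β ^ (-a) * physTrace L β (2 * L) := by
  intro γc hγc
  refine ⟨1 / 400, by norm_num, by norm_num, fun a ha ha' => ?_⟩
  obtain ⟨β₀, hβ₀⟩ := OwnAxis.numerics_of_le ha ha'
  refine ⟨1 / 2 - 4 * a, by linarith, β₀, fun β hβ L _ hLβ => ?_⟩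
  have hL : 1 ≤ L := NeZero.one_le
  obtain ⟨h200, hη, hw, hθ', hσ, hσ1, hfl, hK, hKσ, hQ, hJ, hG, hKa⟩ := hβ₀ β hβ L hL hLβ
  have hβ1 : 1 ≤ β := by linarith
  have hcore : β ^ (-(2 / 5 : ℝ)) ≤ β ^ (-γc) := Real.rpow_le_rpow_of_exponent_le hβ1 (by linarith)
  have hsub : {U : GaugeConfig 3 L SU2 | |polDist U - polDist (configPerm (Equiv.swap (0 : Fin 3) 1) U)| ≤ β ^ (-(1 / 2 - 4 * a)) ∧ β ^ (-γc) < polDist U} ⊆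
      {U : GaugeConfig 3 L SU2 | |polDist U - polDist (configPerm (Equiv.swap (0 : Fin 3) 1) U)| ≤ β ^ (-(1 / 2 - 4 * a)) ∧ β ^ (-(2 / 5 : ℝ)) < polDist U} :=
    fun U hU => ⟨hU.1, hcore.trans_lt hU.2⟩
  have hmono : sectorWeight β (2 * L - 1) (fun _ => false) (fun Us _ =>
        {U : GaugeConfig 3 L SU2 | |polDist U - polDist (configPerm (Equiv.swap (0 : Fin 3) 1) U)| ≤ β ^ (-(1 / 2 - 4 * a)) ∧ β ^ (-γc) < polDist U}.indicator
          (fun _ => (1 : ℝ)) (Us 0)) ≤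
      sectorWeight β (2 * L - 1) (fun _ => false) (fun Us _ =>
        {U : GaugeConfig 3 L SU2 | |polDist U - polDist (configPerm (Equiv.swap (0 : Fin 3) 1) U)| ≤ β ^ (-(1 / 2 - 4 * a)) ∧ β ^ (-(2 / 5 : ℝ)) < polDist U}.indicator
          (fun _ => (1 : ℝ)) (Us 0)) :=
    sectorWeight_mono β (2 * L - 1) (fun _ => false) (C := 1)
      (measurable_uncurry_slice_zero (measurable_const.indicator (OwnAxis.measurableSet_strip' (L := L) _ _)))
      (measurable_uncurry_slice_zero (measurable_const.indicator (OwnAxis.measurableSet_strip' (L := L) _ _)))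
      (fun Us _ => abs_indicator_one_le _ (Us 0)) (fun Us _ => abs_indicator_one_le _ (Us 0))
      (fun Us _ => Set.indicator_le_indicator_of_subset hsub (fun _ => zero_le_one) (Us 0))
  have hwin := OwnAxis.sectorWeight_strip_le_rpow_of_numerics (L := L) (a := a) (η := β ^ (-(19 / 40 : ℝ))) (w := β ^ (-(1 / 2 - 4 * a)))
    (c₀ := β ^ (-(2 / 5 : ℝ))) (σ := β ^ (-(2 / 5 : ℝ)) / 4) (θ' := 6 * β ^ (-(1 / 2 - 4 * a))) (K := ⌈64 * Real.exp 1 * β ^ a⌉₊)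
    h200 hη hw hθ' hσ hσ1 hfl hK hKσ hQ hJ hG hKa
  exact hmono.trans hwin

/-! ## §2 Toron core rarity, the deep off-core strip and the small-ball estimate for every `L ≥ 1` -/

set_option maxHeartbeats 800000 in
/-- **Toron core rarity (sub-quartic cap) for every `L ≥ 1` on the window**: the bookkeeping of `FluxSectorLaplace.closes` (eight-sector decomposition)
over the thresholds-free leaves of §1 and the landed `sectorDecomposition_proof`, `sectorWeightMonotone_proof`. [cite: Luscher1983, §2] [cite: tHooft1979Flux] -/
theorem toronCoreRarity_allL :
    ∃ γc : ℝ, γc ≤ 2 / 5 ∧ ∃ a : ℝ, 0 < a ∧ ∃ β₀ : ℝ, ∀ β : ℝ, β₀ ≤ β → ∀ (L : ℕ) [NeZero L], (L : ℝ) ≤ β ^ a →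
      insTrace L β (Set.indicator {U : GaugeConfig 3 L SU2 | polDist U ≤ β ^ (-γc)} fun _ => (1 : ℝ)) 0 ≤ β ^ (-a) * physTrace L β (2 * L) := by
  obtain ⟨a₁, ha₁, β₁, hF⟩ := fluxSectorSuppression_allL
  obtain ⟨γc, hγc, a₂, ha₂, β₂, hP⟩ := periodicCoreRarity_allL
  have hD := FluxSectorLaplace.sectorDecomposition_proof
  have hM := FluxSectorLaplace.sectorWeightMonotone_proof
  refine ⟨γc, hγc, min a₁ a₂, lt_min ha₁ ha₂, max (max β₁ β₂) 1, ?_⟩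
  intro β hβ L _ hLwin
  have hβ1 : 1 ≤ β := le_trans (le_max_right _ _) hβ
  have hββ1 : β₁ ≤ β := le_trans (le_trans (le_max_left _ _) (le_max_left _ _)) hβ
  have hββ2 : β₂ ≤ β := le_trans (le_trans (le_max_right _ _) (le_max_left _ _)) hβ
  have hLone : 1 ≤ L := NeZero.one_le
  have hβ0 : 0 ≤ β := by linarith
  have hwin1 : (L : ℝ) ≤ β ^ a₁ := hLwin.trans (Real.rpow_le_rpow_of_exponent_le hβ1 (min_le_left _ _))
  have hwin2 : (L : ℝ) ≤ β ^ a₂ := hLwin.trans (Real.rpow_le_rpow_of_exponent_le hβ1 (min_le_right _ _))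
  set A : Set (GaugeConfig 3 L SU2) := {U | polDist U ≤ β ^ (-γc)} with hA
  have hAm : MeasurableSet A := measurableSet_le isPhys_polDist.measurable measurable_const
  set Z := physTrace L β (2 * L) with hZ
  have hZpos : 0 < Z := physTrace_two_mul_pos hLone hβ1
  have hmono : ∀ a' : ℝ, min a₁ a₂ ≤ a' → β ^ (-a') * Z ≤ β ^ (-min a₁ a₂) * Z := by
    intro a' ha'
    refine mul_le_mul_of_nonneg_right ?_ hZpos.le
    exact Real.rpow_le_rpow_of_exponent_le hβ1 (by linarith)
  have hsec : ∀ z : Fin 3 → Bool,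
      sectorWeight (L := L) β (2 * L - 1) z (fun Us _ => A.indicator (fun _ => (1 : ℝ)) (Us 0)) ≤ β ^ (-min a₁ a₂) * Z := by
    intro z
    by_cases hz : z = fun _ => false
    · subst hz
      exact (hP β hββ2 L hwin2).trans (hmono a₂ (min_le_right _ _))
    · have h1 := (hM L β (2 * L - 1) z A hAm hβ0).2
      exact h1.trans ((hF β hββ1 L hwin1 z hz).trans (hmono a₁ (min_le_left _ _)))
  have hcard : (Finset.univ : Finset (Fin 3 → Bool)).card = 8 := by
    simp [Finset.card_univ, Fintype.card_bool, Fintype.card_fin]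
  have hsum : ∑ z : Fin 3 → Bool,
      sectorWeight (L := L) β (2 * L - 1) z (fun Us _ => A.indicator (fun _ => (1 : ℝ)) (Us 0)) ≤ 8 * (β ^ (-min a₁ a₂) * Z) := by
    have := Finset.sum_le_card_nsmul (Finset.univ : Finset (Fin 3 → Bool)) _ _ fun z _ => hsec z
    rw [hcard] at this
    simpa [nsmul_eq_mul] using this
  have hdec := hD L β (2 * L - 1) A hAm
  rw [ringInsTrace_two_mul_sub_one] at hdec
  rw [hdec]
  linarith

set_option maxHeartbeats 800000 in
/-- **The deep off-core strip for every `L ≥ 1` on the window**: the bookkeeping of `ToronSmallBall.offCoreStripWindowDeep_of_sectors` over §1.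
[cite: tHooft1979Flux] [cite: MontvayMunster1994, (3.145)] -/
theorem offCoreStrip_allL :
    ∀ γc : ℝ, γc ≤ 2 / 5 → ∃ a₀ : ℝ, 0 < a₀ ∧ a₀ ≤ 1 ∧ ∀ a : ℝ, 0 < a → a ≤ a₀ → ∃ γ : ℝ, γ < 1 / 2 - 3 * a ∧ ∃ β₀ : ℝ,
      ∀ β : ℝ, β₀ ≤ β → ∀ (L : ℕ) [NeZero L], (L : ℝ) ≤ β ^ a →
        insTrace L β (Set.indicator {U : GaugeConfig 3 L SU2 |
          |polDist U - polDist (configPerm (Equiv.swap (0 : Fin 3) 1) U)| ≤ β ^ (-γ) ∧ β ^ (-γc) < polDist U} fun _ => (1 : ℝ)) 0 ≤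
          β ^ (-a) * physTrace L β (2 * L) := by
  intro γc hγc
  obtain ⟨a₁, ha₁, β₁, h1⟩ := fluxSectorSuppression_allL
  obtain ⟨a₀', ha₀', ha₀'1, hP'⟩ := periodicOffCoreStrip_allL γc hγc
  refine ⟨min a₀' a₁, lt_min ha₀' ha₁, (min_le_left _ _).trans ha₀'1, fun a ha haa₀ => ?_⟩
  obtain ⟨γ, hγ, β₂, h2⟩ := hP' a ha (haa₀.trans (min_le_left _ _))
  refine ⟨γ, hγ, max (max β₁ β₂) 1, fun β hβ L _ hLβ => ?_⟩
  have hββ₁ : β₁ ≤ β := ((le_max_left _ _).trans (le_max_left _ _)).trans hβ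
  have hββ₂ : β₂ ≤ β := ((le_max_right _ _).trans (le_max_left _ _)).trans hβ
  have hβ1 : 1 ≤ β := (le_max_right _ _).trans hβ
  have haa₁ : a ≤ a₁ := haa₀.trans (min_le_right _ _)
  have hLa₁ : (L : ℝ) ≤ β ^ a₁ := hLβ.trans (Real.rpow_le_rpow_of_exponent_le hβ1 haa₁)
  set A : Set (GaugeConfig 3 L SU2) := {U : GaugeConfig 3 L SU2 |
      |polDist U - polDist (configPerm (Equiv.swap (0 : Fin 3) 1) U)| ≤ β ^ (-γ) ∧ β ^ (-γc) < polDist U} with hA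
  have hAm : MeasurableSet A := ToronSmallBall.measurableSet_stripOffCore L _ _
  set Z : ℝ := physTrace L β (2 * L) with hZ
  have hZdef : physTraceSucc L β (2 * L - 1) = Z := rfl
  have hZ0 : 0 ≤ Z := by
    have h := ringInsTrace_indicator_zero_nonneg (L := L) β (2 * L - 1) Set.univ
    rwa [Set.indicator_univ, ringInsTrace_const_one, hZdef] at h
  have hrate : β ^ (-a₁) ≤ β ^ (-a) := Real.rpow_le_rpow_of_exponent_le hβ1 (neg_le_neg haa₁)
  have hsec : ∀ z : Fin 3 → Bool,
      sectorWeight (L := L) β (2 * L - 1) z (fun Us _ => A.indicator (fun _ => (1 : ℝ)) (Us 0)) ≤ β ^ (-a) * Z := by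
    intro z
    by_cases hz : z = fun _ => false
    · rw [hz]; exact h2 β hββ₂ L hLβ
    · have hmono : sectorWeight (L := L) β (2 * L - 1) z (fun Us _ => A.indicator (fun _ => (1 : ℝ)) (Us 0)) ≤
          sectorWeight (L := L) β (2 * L - 1) z (fun _ _ => (1 : ℝ)) :=
        sectorWeight_mono β (2 * L - 1) z (measurable_uncurry_slice_zero (measurable_const.indicator hAm)) measurable_const
          (C := 1) (fun Us _ => abs_indicator_one_le A (Us 0)) (fun _ _ => by rw [abs_one])
          (fun Us _ => Set.indicator_le_self' (fun _ _ => zero_le_one) (Us 0))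
      calc sectorWeight (L := L) β (2 * L - 1) z (fun Us _ => A.indicator (fun _ => (1 : ℝ)) (Us 0))
          ≤ sectorWeight (L := L) β (2 * L - 1) z (fun _ _ => (1 : ℝ)) := hmono
        _ ≤ β ^ (-a₁) * Z := h1 β hββ₁ L hLa₁ z hz
        _ ≤ β ^ (-a) * Z := mul_le_mul_of_nonneg_right hrate hZ0
  have hcard : (Finset.univ : Finset (Fin 3 → Bool)).card = 8 := by
    rw [Finset.card_univ, Fintype.card_fun, Fintype.card_bool, Fintype.card_fin]; norm_num
  rw [← ringInsTrace_two_mul_sub_one, ringInsTrace_indicator_zero_eq_sum_sectorWeight β (2 * L - 1) hAm]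
  have hsum : ∑ z : Fin 3 → Bool, sectorWeight (L := L) β (2 * L - 1) z (fun Us _ => A.indicator (fun _ => (1 : ℝ)) (Us 0)) ≤
      8 * (β ^ (-a) * Z) := by
    have h := Finset.sum_le_card_nsmul (Finset.univ : Finset (Fin 3 → Bool))
      (fun z => sectorWeight (L := L) β (2 * L - 1) z (fun Us _ => A.indicator (fun _ => (1 : ℝ)) (Us 0))) (β ^ (-a) * Z)
      (fun z _ => hsec z)
    rwa [hcard, nsmul_eq_mul, Nat.cast_ofNat] at h
  calc (1 / 8 : ℝ) * ∑ z : Fin 3 → Bool, sectorWeight (L := L) β (2 * L - 1) z (fun Us _ => A.indicator (fun _ => (1 : ℝ)) (Us 0))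
      ≤ (1 / 8 : ℝ) * (8 * (β ^ (-a) * Z)) := mul_le_mul_of_nonneg_left hsum (by norm_num)
    _ = β ^ (-a) * Z := by ring

set_option maxHeartbeats 800000 in
/-- **(SB) for every `L ≥ 1` on the window**, with constant one: there are `0 < a ≤ 1`, `γ < 1/2 − 4a`, `β₀` such that for `β ≥ β₀` and every `L ≥ 1`
with `L ≤ β^a`, `insTrace L β 𝟙{|polDist − polDist∘S| ≤ β^{−γ}} 0 ≤ β^{−a}·Z_phys(2L)` (union bound `STRIP ⊆ CORE ∪ (STRIP ∩ OFF-CORE)` over §2).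
[cite: Luscher1983, §2] [cite: MontvayMunster1994, (3.145)] -/
theorem smallBall_allL :
    ∃ a : ℝ, 0 < a ∧ a ≤ 1 ∧ ∃ γ : ℝ, γ < 1 / 2 - 4 * a ∧
      ∃ β₀ : ℝ, ∀ β : ℝ, β₀ ≤ β → ∀ (L : ℕ) [NeZero L], (L : ℝ) ≤ β ^ a →
        insTrace L β (Set.indicator {U : GaugeConfig 3 L SU2 |
            |polDist U - polDist (configPerm (Equiv.swap (0 : Fin 3) 1) U)| ≤ β ^ (-γ)} fun _ => (1 : ℝ)) 0 ≤
          β ^ (-a) * physTrace L β (2 * L) := by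
  obtain ⟨γc, hγc, a₁, ha₁, β₁, h1⟩ := toronCoreRarity_allL
  obtain ⟨a₀, ha₀, ha₀1, h2⟩ := offCoreStrip_allL γc hγc
  set a' : ℝ := min a₀ a₁ with ha'
  have ha'0 : 0 < a' := lt_min ha₀ ha₁
  have ha'₀ : a' ≤ a₀ := min_le_left _ _
  have ha'₁ : a' ≤ a₁ := min_le_right _ _
  have ha'1 : a' ≤ 1 := ha'₀.trans ha₀1
  obtain ⟨γ, hγ, β₂, h2'⟩ := h2 a' ha'0 ha'₀
  refine ⟨a' / 4, by positivity, by linarith, γ, by linarith, max (max β₁ β₂) (max 1 ((2 : ℝ) ^ (4 / (3 * a')))),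
    fun β hβ L _ hLβ => ?_⟩
  have hββ₁ : β₁ ≤ β := ((le_max_left _ _).trans (le_max_left _ _)).trans hβ
  have hββ₂ : β₂ ≤ β := ((le_max_right _ _).trans (le_max_left _ _)).trans hβ
  have hβ1 : 1 ≤ β := ((le_max_left _ _).trans (le_max_right _ _)).trans hβ
  have hβ2 : (2 : ℝ) ^ (4 / (3 * a')) ≤ β := ((le_max_right _ _).trans (le_max_right _ _)).trans hβ
  have hβ0 : 0 < β := by linarith
  have hL1 : 1 ≤ L := NeZero.one_le
  have hLβ₁ : (L : ℝ) ≤ β ^ a₁ := hLβ.trans (Real.rpow_le_rpow_of_exponent_le hβ1 (by linarith))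
  have hLβ' : (L : ℝ) ≤ β ^ a' := hLβ.trans (Real.rpow_le_rpow_of_exponent_le hβ1 (by linarith))
  have hcore := h1 β hββ₁ L hLβ₁
  have hoff := h2' β hββ₂ L hLβ'
  set S := configPerm (G := FemtoTransferGap.SU2) (L := L) (Equiv.swap (0 : Fin 3) 1) with hS
  set Z : ℝ := physTrace L β (2 * L) with hZ
  have hZpos : 0 < Z := physTrace_two_mul_pos hL1 hβ1
  set CORE : Set (GaugeConfig 3 L FemtoTransferGap.SU2) := {U | polDist U ≤ β ^ (-γc)} with hCORE
  set OFF : Set (GaugeConfig 3 L FemtoTransferGap.SU2) := {U | |polDist U - polDist (S U)| ≤ β ^ (-γ) ∧ β ^ (-γc) < polDist U} with hOFF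
  set STRIP : Set (GaugeConfig 3 L FemtoTransferGap.SU2) := {U | |polDist U - polDist (S U)| ≤ β ^ (-γ)} with hSTRIP
  have hCOREm : MeasurableSet CORE := measurableSet_le isPhys_polDist.measurable measurable_const
  have hOFFm : MeasurableSet OFF :=
    (measurableSet_strip _).inter (measurableSet_lt measurable_const isPhys_polDist.measurable)
  have hSTRIPm : MeasurableSet STRIP := measurableSet_strip _
  have hsub : STRIP ⊆ CORE ∪ OFF := fun U hU => by
    by_cases hc : polDist U ≤ β ^ (-γc)
    · exact Or.inl hc
    · exact Or.inr ⟨hU, not_le.1 hc⟩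
  have hstrip : insTrace L β (STRIP.indicator fun _ => (1 : ℝ)) 0 ≤ (β ^ (-a₁) + β ^ (-a')) * Z := by
    calc insTrace L β (STRIP.indicator fun _ => (1 : ℝ)) 0 ≤ insTrace L β ((CORE ∪ OFF).indicator fun _ => (1 : ℝ)) 0 :=
          insTrace_indicator_zero_mono hβ0.le hSTRIPm (hCOREm.union hOFFm) hsub
      _ ≤ insTrace L β (CORE.indicator fun _ => (1 : ℝ)) 0 + insTrace L β (OFF.indicator fun _ => (1 : ℝ)) 0 :=
          insTrace_indicator_zero_union_le hβ0.le hCOREm hOFFm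
      _ ≤ β ^ (-a₁) * Z + β ^ (-a') * Z := add_le_add hcore hoff
      _ = (β ^ (-a₁) + β ^ (-a')) * Z := by ring
  have hmono : β ^ (-a₁) ≤ β ^ (-a') := Real.rpow_le_rpow_of_exponent_le hβ1 (by linarith)
  have h2le : (2 : ℝ) ≤ β ^ (3 * a' / 4) := by
    have h := Real.rpow_le_rpow (by positivity) hβ2 (by positivity : (0 : ℝ) ≤ 3 * a' / 4)
    rwa [← Real.rpow_mul (by norm_num), show 4 / (3 * a') * (3 * a' / 4) = 1 by field_simp, Real.rpow_one] at h
  have hkey : β ^ (-a₁) + β ^ (-a') ≤ β ^ (-(a' / 4)) := by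
    have e1 : β ^ (-(a' / 4)) = β ^ (-a') * β ^ (3 * a' / 4) := by
      rw [← Real.rpow_add hβ0]; congr 1; ring
    have hpos : 0 ≤ β ^ (-a') := Real.rpow_nonneg hβ0.le _
    calc β ^ (-a₁) + β ^ (-a') ≤ 2 * β ^ (-a') := by linarith
      _ = β ^ (-a') * 2 := mul_comm _ _
      _ ≤ β ^ (-a') * β ^ (3 * a' / 4) := mul_le_mul_of_nonneg_left h2le hpos
      _ = β ^ (-(a' / 4)) := e1.symm
  calc insTrace L β (STRIP.indicator fun _ => (1 : ℝ)) 0 ≤ (β ^ (-a₁) + β ^ (-a')) * Z := hstrip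
    _ ≤ β ^ (-(a' / 4)) * Z := mul_le_mul_of_nonneg_right hkey hZpos.le

end Summit.QuantumFields.YangMills.Theorems.SwapTwistDeficit

end
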